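import Mathlib
import Summits.Ventures.PercRepro2.StarHMasses
import Summits.Ventures.PercRepro2.StarHXhatCells

/-!
# The closed form of `HMFc` at the four-coin hub star `{a₁, a₂, o, b}` (blind cell PercRepro2,
night-1 g11; NIGHT1-G11.md §5; filed by night-1 g12 on the re-emitted chain)

`HMFc_star_h`: for `a₃` adjacent exactly to `a₁` (coin `α`), `a₂` (`β`), `o` (`r`) and `b` (`s`),
every weight vector, `G − a₃` arbitrary: `HMFc = hmfcMassH` of the ten cells of the star-zeroed
table, the two cluster functionals `G_ob = Eprod'`, `G′_ob`, the isolated term `X0 = termW {a₃}` and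
the four coins — the seventeen masses by their sixteen-outcome readings (`StarHMasses`), the mean
field by `Xhat_star_h_cells`, `gap = P(Q, bH) − P(Q, bL)` by `PocketConn.gap_eq_on_Q`.
-/

namespace Summit.Ventures.PercRepro2

open StarGlue PendantRoot

namespace StarH

section Main

variable {V : Type*} {E : Type*} [Fintype E] [DecidableEq E] [Fintype V] [DecidableEq V]
  {R : Type*} [Field R] [LinearOrder R] [IsStrictOrderedRing R]

variable (p : E → R) (ends : E → Sym2 V) {f₁ f₂ f₃ f₄ : E} {a₃ a₁ a₂ o b : V}

open StarO (pOut)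

omit [LinearOrder R] [IsStrictOrderedRing R] in
/-- **The closed form of `HMFc` at the hub star.** -/
theorem HMFc_star_h (hf₁ : ends f₁ = s(a₃, a₁)) (hf₂ : ends f₂ = s(a₃, a₂))
    (hf₃ : ends f₃ = s(a₃, o)) (hf₄ : ends f₄ = s(a₃, b))
    (hstar : ∀ e, a₃ ∈ ends e → e = f₁ ∨ e = f₂ ∨ e = f₃ ∨ e = f₄)
    (h31 : a₃ ≠ a₁) (h32 : a₃ ≠ a₂) (h3o : a₃ ≠ o) (h3b : a₃ ≠ b) (h12 : f₁ ≠ f₂) (h13 : f₁ ≠ f₃)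
    (h14 : f₁ ≠ f₄) (h23 : f₂ ≠ f₃) (h24 : f₂ ≠ f₄) (h34 : f₃ ≠ f₄) :
    HMFc p ends o a₁ a₂ a₃ b =
      hmfcMassH (prob (pOut p ends a₃) (cLL ends a₁ a₂ o b)) (prob (pOut p ends a₃) (cLH ends a₁ a₂ o b))
        (prob (pOut p ends a₃) (cLN ends a₁ a₂ o b)) (prob (pOut p ends a₃) (cHL ends a₁ a₂ o b))
        (prob (pOut p ends a₃) (cHH ends a₁ a₂ o b)) (prob (pOut p ends a₃) (cHN ends a₁ a₂ o b))
        (prob (pOut p ends a₃) (cNL ends a₁ a₂ o b)) (prob (pOut p ends a₃) (cNH ends a₁ a₂ o b))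
        (prob (pOut p ends a₃) (cNNt ends a₁ a₂ o b)) (prob (pOut p ends a₃) (cNNs ends a₁ a₂ o b))
        (PocketConn.Eprod' (pOut p ends a₃) ends o a₁ a₂ b)
        (PocketConn.Eprod' (pOut p ends a₃) ends o a₂ a₁ b)
        (termW p ends o a₁ a₂ b {a₃}) (p f₁) (p f₂) (p f₃) (p f₄) := by
  have mQ := mass_Q p ends hf₁ hf₂ hf₃ hf₄ hstar h31 h32 h3o h3b h12 h13 h14 h23 h24 h34
  have mPD := mass_PD p ends hf₁ hf₂ hf₃ hf₄ hstar h31 h32 h3o h3b h12 h13 h14 h23 h24 h34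
  have mPDoL := mass_PDoL p ends hf₁ hf₂ hf₃ hf₄ hstar h31 h32 h3o h3b h12 h13 h14 h23 h24 h34
  have mPDoH := mass_PDoH p ends hf₁ hf₂ hf₃ hf₄ hstar h31 h32 h3o h3b h12 h13 h14 h23 h24 h34
  have mPDbH := mass_PDbH p ends hf₁ hf₂ hf₃ hf₄ hstar h31 h32 h3o h3b h12 h13 h14 h23 h24 h34
  have mT := mass_T p ends hf₁ hf₂ hf₃ hf₄ hstar h31 h32 h3o h3b h12 h13 h14 h23 h24 h34
  have mTbH := mass_TbH p ends hf₁ hf₂ hf₃ hf₄ hstar h31 h32 h3o h3b h12 h13 h14 h23 h24 h34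
  have mTbL := mass_TbL p ends hf₁ hf₂ hf₃ hf₄ hstar h31 h32 h3o h3b h12 h13 h14 h23 h24 h34
  have mToL := mass_ToL p ends hf₁ hf₂ hf₃ hf₄ hstar h31 h32 h3o h3b h12 h13 h14 h23 h24 h34
  have mToH := mass_ToH p ends hf₁ hf₂ hf₃ hf₄ hstar h31 h32 h3o h3b h12 h13 h14 h23 h24 h34
  have mTp := mass_Tp p ends hf₁ hf₂ hf₃ hf₄ hstar h31 h32 h3o h3b h12 h13 h14 h23 h24 h34
  have mTpoL := mass_TpoL p ends hf₁ hf₂ hf₃ hf₄ hstar h31 h32 h3o h3b h12 h13 h14 h23 h24 h34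
  have mTpoH := mass_TpoH p ends hf₁ hf₂ hf₃ hf₄ hstar h31 h32 h3o h3b h12 h13 h14 h23 h24 h34
  have mQoL := mass_QoL p ends hf₁ hf₂ hf₃ hf₄ hstar h31 h32 h3o h3b h12 h13 h14 h23 h24 h34
  have mQoH := mass_QoH p ends hf₁ hf₂ hf₃ hf₄ hstar h31 h32 h3o h3b h12 h13 h14 h23 h24 h34
  have mQbH := mass_QbH p ends hf₁ hf₂ hf₃ hf₄ hstar h31 h32 h3o h3b h12 h13 h14 h23 h24 h34
  have mQbL := mass_QbL p ends hf₁ hf₂ hf₃ hf₄ hstar h31 h32 h3o h3b h12 h13 h14 h23 h24 h34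
  have mX := Xhat_star_h_cells p ends hf₁ hf₂ hf₃ hf₄ hstar h31 h32 h3o h3b h12 h13 h14 h23 h24 h34
  have eT1 : connEvent ends a₂ b ∩ TEvent ends a₁ a₂ a₃ = TEvent ends a₁ a₂ a₃ ∩ connEvent ends a₂ b :=
    Set.inter_comm _ _
  have eT2 : connEvent ends a₁ b ∩ TEvent ends a₁ a₂ a₃ = TEvent ends a₁ a₂ a₃ ∩ connEvent ends a₁ b :=
    Set.inter_comm _ _
  have egap := PocketConn.gap_eq_on_Q p ends a₁ a₂ b
  rw [← avoidAll_eq_compl] at egap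
  unfold HMFc CovForm.marginC CovForm.DEF CovForm.EQo CovForm.EQ3 CovForm.EQ3o CovForm.Do massM2 deltaT
  rw [eT1, eT2, egap, mQ, mPD, mPDoL, mPDoH, mPDbH, mTbH, mTbL, mT, mToL, mToH, mTp, mTpoL, mTpoH,
    mQoL, mQoH, mQbH, mQbL, mX]
  unfold hmfcMassH
  ring

end Main

end StarH

end Summit.Ventures.PercRepro2
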